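import Summits.ValiantsHypothesis.ValiantsHypothesis.Theorems.KPlusLogSqLawTropicalBBlockOrder

/-!
# Route «KPlusLogSqLaw», crux `TropicalB` (stmt-ValiantsHypothesis-19771) — RECOMBINATION CUBES ARE MET IN NESTED CHAINS:
# between two dominant terms at most `#differing columns + 1` of their splices are dominant

HONEST FRAMING.  Helper file of the object-search cell `pub-symmetroid` (seat val-sym-trop-p2 g3) for the crux
`Summit.ValiantsHypothesis.ValiantsHypothesis.Theses.KPlusLogSqLaw.TropicalB` (ledger item `stmt-ValiantsHypothesis-19771`, route
`KPlusLogSqLaw`; registered stubs `stub_tropThin` / `stub_tropFat` of `Cruxes/TropicalB/Lines/birth.lean`, each ⟺ the crux), landed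
`--supports`; it does NOT close the item and asserts nothing about `TropicalB` in its window, `WeakLifting`, `KPlusLogSqLaw`,
`MatrixDescartes` (stmt-ValiantsHypothesis-18050) or `VP ≠ VNP`.  STRUCTURAL facts about unique optima (`IsDominant`) of an ARBITRARY
dominance design `(d, v, ε)` of an arbitrary format `(m, K)`: no support class, no exponent regime, no sign condition, no chain.

THE FACT (corollary of the block order law `BlockOrder.block_order`, this seat's `…TropicalBBlockOrder`).  Let `a` be dominant at `θa`
and `b` at `θb > θa`.  A SPLICE of the pair is a term carrying `b`'s (row, class) data on a column set `S` invariant under the quotient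
`σ_a⁻¹σ_b` and `a`'s data off `S` (`IntervalOpt.restr S x = IntervalOpt.restr S b`, `IntervalOpt.AgreeOut S a x`); the splices are the
`2^{#cycles}` present terms of the RECOMBINATION CUBE of the pair (cycles of the quotient on the columns where `a ≠ b`, class-only columns
counting as 1-cycles) — the hidden terms every register construction of the cell has to dominate.
* `SpliceChain.splice_nested` — if the splice `x` is dominant at `θx` and the splice `y` at `θy > θx`, then every column where `x` has
  left `a` is a column where `y` carries `b`: the SWITCHED SETS ARE NESTED and grow with the slope (no block is ever switched back).
* `SpliceChain.eq_of_switched_eq` — a splice is determined by its switched set.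
* `SpliceChain.card_dominant_splices_le` — **at most `#{c : a c ≠ b c} + 1 ≤ m + 1` splices of a dominant pair are dominant** (their
  switched sets form a chain of distinct subsets of the differing columns, so their cardinalities are pairwise distinct).  For a
  product design (direct sum / torus / block cut) EVERY term is a splice of the extreme pair, and this is the «autonomous registers meet
  additively» count (`IntervalOpt.card_optRestr_union_le`, R9 of HOME/val-sym-trop-p2/g2/REGISTERS-g2.md) without the product hypothesis:
  the exponential recombination cube of ANY dominant pair carries only linearly many dominant terms, visited as a growing chain.

[folklore: exchange arguments for parametric assignment; the packaging is the cell's]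
-/

-- `Summit.ValiantsHypothesis.ValiantsHypothesis.…` repeats a component by the D-0017 layout
-- (single-conjunct summit), which the `dupNamespace` linter flags; the name is mandated.
set_option linter.dupNamespace false
set_option autoImplicit false

namespace Summit.ValiantsHypothesis.ValiantsHypothesis.Theorems.KPlusLogSqLaw

open Summit.ValiantsHypothesis.ValiantsHypothesis.Theorems.MatrixDescartes.Negative
open scoped BigOperators
open Finset

namespace SpliceChain

variable {m K : ℕ} {d : Fin K → ℕ} {v ε : Fin m → Fin m → Fin K → ℤ}

/-- the difference of two invariant column sets is invariant. [folklore] -/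
theorem invariant_sdiff {π : Equiv.Perm (Fin m)} {S S' : Finset (Fin m)} (hS : ∀ b, π b ∈ S ↔ b ∈ S)
    (hS' : ∀ b, π b ∈ S' ↔ b ∈ S') : ∀ b, π b ∈ S \ S' ↔ b ∈ S \ S' := by
  intro b
  rw [Finset.mem_sdiff, Finset.mem_sdiff, hS b, hS' b]

/-- **NESTED SWITCHING.**  `a` dominant at `θa`, `b` at `θb > θa`; `x` a splice along the invariant set `S`, dominant at `θx`; `y` a
splice along the invariant set `S'`, dominant at `θy > θx`.  Then wherever `x` differs from `a`, `y` carries `b` (and `a ≠ b` there):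
the switched set of the later dominant splice contains that of the earlier one. [folklore] -/
theorem splice_nested {θa θb θx θy : ℤ} {a b x y : Equiv.Perm (Fin m) × (Fin m → Fin K)}
    (ha : IsDominant d v ε θa a) (hb : IsDominant d v ε θb b) (hab : θa < θb)
    {S S' : Finset (Fin m)} (hS : ∀ j, (a.1⁻¹ * b.1) j ∈ S ↔ j ∈ S) (hS' : ∀ j, (a.1⁻¹ * b.1) j ∈ S' ↔ j ∈ S')
    (hx : IsDominant d v ε θx x) (hxS : IntervalOpt.restr S x = IntervalOpt.restr S b) (hxo : IntervalOpt.AgreeOut S a x)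
    (hy : IsDominant d v ε θy y) (hyS : IntervalOpt.restr S' y = IntervalOpt.restr S' b) (hyo : IntervalOpt.AgreeOut S' a y)
    (hxy : θx < θy) (c : Fin m) (hc : (x.1 c, x.2 c) ≠ (a.1 c, a.2 c)) : (y.1 c, y.2 c) = (b.1 c, b.2 c) := by
  classical
  -- `c ∈ S` (else `x = a` at `c`) and `a ≠ b` at `c`
  have hcS : c ∈ S := by
    by_contra h
    obtain ⟨e1, e2⟩ := hxo c h
    exact hc (by rw [e1, e2])
  have hxb : (x.1 c, x.2 c) = (b.1 c, b.2 c) := by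
    obtain ⟨e1, e2⟩ := IntervalOpt.restr_eq_iff.1 hxS c hcS
    rw [e1, e2]
  by_cases hcS' : c ∈ S'
  · obtain ⟨e1, e2⟩ := IntervalOpt.restr_eq_iff.1 hyS c hcS'
    rw [e1, e2]
  · -- `c ∈ U := S \\ S'`, an invariant block on which `x` carries `b` and `y` carries `a`: the block order law forbids `θx < θy`
    exfalso
    set U := S \ S' with hU
    have hUinv : ∀ j, (a.1⁻¹ * b.1) j ∈ U ↔ j ∈ U := invariant_sdiff hS hS'
    have hxU : IntervalOpt.restr U x = IntervalOpt.restr U b := IntervalOpt.restr_mono Finset.sdiff_subset hxS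
    have hyU : IntervalOpt.restr U y = IntervalOpt.restr U a := by
      refine IntervalOpt.restr_eq_iff.2 fun i hi => ?_
      obtain ⟨e1, e2⟩ := hyo i (Finset.mem_sdiff.1 hi).2
      exact ⟨e1.symm, e2.symm⟩
    have hneU : IntervalOpt.restr U a ≠ IntervalOpt.restr U b := by
      intro h
      have hcU : c ∈ U := Finset.mem_sdiff.2 ⟨hcS, hcS'⟩
      obtain ⟨e1, e2⟩ := IntervalOpt.restr_eq_iff.1 h c hcU
      apply hc
      rw [hxb, e1, e2]
    have := BlockOrder.block_order ha hb hab U hUinv hneU hx hxU hy hyU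
    exact lt_asymm hxy this

/-- the switched set of a splice: the columns where it differs from `a` (there it carries `b`). [folklore] -/
theorem switched_spec {a b x : Equiv.Perm (Fin m) × (Fin m → Fin K)} {S : Finset (Fin m)}
    (hxS : IntervalOpt.restr S x = IntervalOpt.restr S b) (hxo : IntervalOpt.AgreeOut S a x) (c : Fin m) :
    (x.1 c, x.2 c) = if (x.1 c, x.2 c) ≠ (a.1 c, a.2 c) then (b.1 c, b.2 c) else (a.1 c, a.2 c) := by
  classical
  split_ifs with h
  · have hcS : c ∈ S := by
      by_contra h'
      obtain ⟨e1, e2⟩ := hxo c h'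
      exact h (by rw [e1, e2])
    obtain ⟨e1, e2⟩ := IntervalOpt.restr_eq_iff.1 hxS c hcS
    rw [e1, e2]
  · push Not at h
    exact h

/-- **a splice is determined by its switched set.** [folklore] -/
theorem eq_of_switched_eq {a b x y : Equiv.Perm (Fin m) × (Fin m → Fin K)} {S S' : Finset (Fin m)}
    (hxS : IntervalOpt.restr S x = IntervalOpt.restr S b) (hxo : IntervalOpt.AgreeOut S a x)
    (hyS : IntervalOpt.restr S' y = IntervalOpt.restr S' b) (hyo : IntervalOpt.AgreeOut S' a y)
    (h : ∀ c, (x.1 c, x.2 c) ≠ (a.1 c, a.2 c) ↔ (y.1 c, y.2 c) ≠ (a.1 c, a.2 c)) : x = y := by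
  classical
  have hc : ∀ c, (x.1 c, x.2 c) = (y.1 c, y.2 c) := by
    intro c
    rw [switched_spec hxS hxo c, switched_spec hyS hyo c]
    by_cases hx : (x.1 c, x.2 c) ≠ (a.1 c, a.2 c)
    · rw [if_pos hx, if_pos ((h c).1 hx)]
    · have hy : ¬ (y.1 c, y.2 c) ≠ (a.1 c, a.2 c) := fun hy => hx ((h c).2 hy)
      rw [if_neg hx, if_neg hy]
  refine Prod.ext (Equiv.ext fun c => ?_) (funext fun c => ?_)
  · exact (Prod.mk.injEq _ _ _ _).mp (hc c) |>.1
  · exact (Prod.mk.injEq _ _ _ _).mp (hc c) |>.2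

/-- **AT MOST `#{a ≠ b} + 1` DOMINANT SPLICES.**  For a dominant pair `(a, b)` (`θa < θb`) and a finite family `F` of pairwise distinct
terms, each dominant at some integer slope `θ f` and each a splice of the pair along some invariant column set `S f`, the family has at most
`#{c : a c ≠ b c} + 1` members: the recombination cube of a dominant pair, of size up to `2^{#cycles}`, carries only linearly many dominant
terms, and they switch a nested chain of blocks. [folklore] -/
theorem card_dominant_splices_le {θa θb : ℤ} {a b : Equiv.Perm (Fin m) × (Fin m → Fin K)}
    (ha : IsDominant d v ε θa a) (hb : IsDominant d v ε θb b) (hab : θa < θb)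
    (F : Finset (Equiv.Perm (Fin m) × (Fin m → Fin K))) (θ : Equiv.Perm (Fin m) × (Fin m → Fin K) → ℤ)
    (S : Equiv.Perm (Fin m) × (Fin m → Fin K) → Finset (Fin m))
    (hdom : ∀ f ∈ F, IsDominant d v ε (θ f) f)
    (hS : ∀ f ∈ F, ∀ j, (a.1⁻¹ * b.1) j ∈ S f ↔ j ∈ S f)
    (hsp : ∀ f ∈ F, IntervalOpt.restr (S f) f = IntervalOpt.restr (S f) b ∧ IntervalOpt.AgreeOut (S f) a f) :
    F.card ≤ (univ.filter fun c : Fin m => (a.1 c, a.2 c) ≠ (b.1 c, b.2 c)).card + 1 := by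
  classical
  set D := univ.filter fun c : Fin m => (a.1 c, a.2 c) ≠ (b.1 c, b.2 c) with hD
  -- switched set of a member
  let Sw : Equiv.Perm (Fin m) × (Fin m → Fin K) → Finset (Fin m) :=
    fun f => univ.filter fun c => (f.1 c, f.2 c) ≠ (a.1 c, a.2 c)
  have hSwD : ∀ f ∈ F, Sw f ⊆ D := by
    intro f hf c hc
    simp only [Sw, Finset.mem_filter, Finset.mem_univ, true_and] at hc
    simp only [hD, Finset.mem_filter, Finset.mem_univ, true_and]
    have e := switched_spec (hsp f hf).1 (hsp f hf).2 c
    rw [if_pos hc] at e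
    intro hab'
    exact hc (e.trans hab'.symm)
  -- nested switched sets between two members
  have hnest : ∀ f ∈ F, ∀ g ∈ F, θ f < θ g → Sw f ⊆ Sw g := by
    intro f hf g hg hfg c hc
    simp only [Sw, Finset.mem_filter, Finset.mem_univ, true_and] at hc ⊢
    have e := splice_nested ha hb hab (hS f hf) (hS g hg) (hdom f hf) (hsp f hf).1 (hsp f hf).2 (hdom g hg)
      (hsp g hg).1 (hsp g hg).2 hfg c hc
    rw [e]
    have hcD := hSwD f hf (by simpa [Sw] using hc)
    simp only [hD, Finset.mem_filter, Finset.mem_univ, true_and] at hcD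
    exact Ne.symm hcD
  -- the cardinality of the switched set is injective on `F`
  have hinj : Set.InjOn (fun f => (Sw f).card) F := by
    intro f hf g hg hcard
    simp only at hcard
    by_contra hne
    have hθ : θ f ≠ θ g := by
      intro h
      exact hne (BlockOrder.eq_of_isDominant_same (hdom f hf) (h ▸ hdom g hg))
    have key : ∀ {f g}, f ∈ F → g ∈ F → θ f < θ g → (Sw f).card = (Sw g).card → f = g := by
      intro f g hf hg hlt hc
      have hsub := hnest f hf g hg hlt
      have heq : Sw f = Sw g := Finset.eq_of_subset_of_card_le hsub hc.ge
      apply eq_of_switched_eq (hsp f hf).1 (hsp f hf).2 (hsp g hg).1 (hsp g hg).2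
      intro c
      have := congrArg (fun s => c ∈ s) heq
      simp only [Sw, Finset.mem_filter, Finset.mem_univ, true_and] at this
      exact Iff.of_eq this
    rcases lt_or_gt_of_ne hθ with h | h
    · exact hne (key hf hg h hcard)
    · exact hne (key hg hf h hcard.symm).symm
  -- into the range `0 … #D`
  have hmaps : ∀ f ∈ F, (fun f => (Sw f).card) f ∈ Finset.range (D.card + 1) := by
    intro f hf
    exact Finset.mem_range.2 (Nat.lt_succ_of_le (Finset.card_le_card (hSwD f hf)))
  calc F.card ≤ (Finset.range (D.card + 1)).card := Finset.card_le_card_of_injOn _ hmaps hinj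
    _ = D.card + 1 := Finset.card_range _

end SpliceChain

end Summit.ValiantsHypothesis.ValiantsHypothesis.Theorems.KPlusLogSqLaw
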